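import Mathlib
import Literature.Probability.LatticeModels.TorusFourierDyadicBlocks
import HarnessLib

/-!
# Dyadic (Bernstein) blocks, II: weighted `ℓ¹` norms and position moments of lattice kernels from TWO difference laws

Topic `Probability/LatticeModels`; sequel of `TorusFourierDyadicBlocks.lean` (the coarse step `blockStep L A`, block Plancherel on
the cube shells `cubeShell d L A = {A ≤ |x̃|_∞ < 2A}`, `#S_A ≤ (4A)^d`).  Here the assembly of Bernstein's theorem in finite,
uniform-in-`L` form (`g(x) = Σ_k χ_k(x) h(k)` a character sum over the dual torus `(ℤ/Lℤ)^d`, kernel normalisation `L^{-d} g`):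

* §4 **`sum_cubeShell_weight_mul_norm_le`** / **`…_kernel_le`** — for `0 ≤ w ≤ W` on `S_A` and `‖(Δ_{m(A)e_i}^N h)(k)‖ ≤ D`:
  `Σ_{S_A} w(x)‖L^{-d}g(x)‖ ≤ W · √((4A)^d) · 4^N · √d · D` (Cauchy–Schwarz on the shell + block Plancherel), for EVERY order `N`;
* §5 **`sum_le_apply_zero_add_sum_cubeShell`** — the dyadic cover `Σ_x F(x) ≤ F(0) + Σ_{j ≤ log₂ L} Σ_{S_{2^j}} F(x)` (`F ≥ 0`);
  **`sum_min_geom_le`** — `Σ_{j<J} min(a·2^j, b/2^j) ≤ a·2^t + 2b/2^t` for every integer crossover `t`;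
  **`sum_weight_mul_norm_kernel_le_dyadic`** — the assembled bound: each shell paid by the better of two difference laws
  `N₁`, `N₂` (so a position moment of order `s` needs laws straddling `s + d/2`, not one law above it — the Besov `B^{s+d/2}_{2,1}`
  mechanism; e.g. the first moment in `d = 2` from the first and third derivative laws of a sampled symbol, `≲ √(‖DK‖·‖D³K‖)`).

Everything is proved; no definitions, no named facts.

## Sources

A. Zygmund, *Trigonometric Series* Vol. I, CUP 2002, Ch. VI §3 (Bernstein's theorem, Thm 3.1) [`Zygmund2002`];
Y. Katznelson, *An Introduction to Harmonic Analysis*, 3rd ed., CUP 2004, Ch. I §6.3 [`Katznelson2004`];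
S. Friedli, Y. Velenik, *Statistical Mechanics of Lattice Systems*, CUP 2017, §10.4 [`FriedliVelenik2017`].
-/

noncomputable section

open Finset Complex
open scoped Real ComplexConjugate

namespace Literature.Probability.LatticeModels

variable {d L : ℕ} [NeZero L]

/-! ### §4 The weighted block `ℓ¹` bound -/

/-- Shells beyond `L/2` are EMPTY: if `L < 2A` then `cubeShell d L A = ∅` (`|x̃|_∞ ≤ L/2`). [cite: Zygmund2002, Ch. VI §3 (proof of Thm 3.1)] -/
theorem cubeShell_eq_empty_of_lt {A : ℕ} (h : L < 2 * A) : cubeShell d L A = ∅ := by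
  ext x
  simp only [mem_cubeShell, Finset.notMem_empty, iff_false, not_and, not_lt]
  intro hA
  have := (hA.trans (torusSupNorm_le_half x))
  omega


/-- **The weighted `ℓ¹` norm of a character sum over a cube shell**: if `0 ≤ w ≤ W` on `S_A` and the `N`-th coarse axis
differences of the symbol are bounded by `D` (`‖(Δ_{m(A)e_i}^N h)(k)‖ ≤ D` for all `i`, `k`), then
`Σ_{x ∈ S_A} w(x) ‖Σ_k χ_k(x) h(k)‖ ≤ W · √((4A)^d) · 4^N · √d · L^d · D` (Cauchy–Schwarz on `#S_A ≤ (4A)^d` and block Plancherel).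
[cite: Zygmund2002, Ch. VI §3 Thm 3.1] -/
theorem sum_cubeShell_weight_mul_norm_le (h : TorusSite d L → ℂ) {A : ℕ} (hA : 0 < A) (N : ℕ) (w : TorusSite d L → ℝ)
    {W D : ℝ} (hW : 0 ≤ W) (hD0 : 0 ≤ D) (hwW : ∀ x ∈ cubeShell d L A, w x ≤ W)
    (hD : ∀ (i : Fin d) (k : TorusSite d L),
      ‖((fwdDiff (blockStep L A • (Pi.single i (1 : ZMod L) : TorusSite d L)))^[N] h) k‖ ≤ D) :
    ∑ x ∈ cubeShell d L A, w x * ‖∑ k, torusChar k x * h k‖ ≤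
      W * (Real.sqrt ((4 * A : ℝ) ^ d) * (4 : ℝ) ^ N * Real.sqrt d * (L : ℝ) ^ d * D) := by
  set S := cubeShell d L A with hS
  set g : TorusSite d L → ℝ := fun x => ‖∑ k, torusChar k x * h k‖ with hg
  have hg0 : ∀ x, 0 ≤ g x := fun x => norm_nonneg _
  have hL : (0 : ℝ) ≤ (L : ℝ) ^ d := by positivity
  -- (1) pull out the weight
  have h1 : ∑ x ∈ S, w x * g x ≤ W * ∑ x ∈ S, g x := by
    rw [mul_sum]
    exact sum_le_sum fun x hx => mul_le_mul_of_nonneg_right (hwW x hx) (hg0 x)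
  -- (2) Cauchy–Schwarz on the shell and block Plancherel
  have h2 : (∑ x ∈ S, g x) ^ 2 ≤ #S * ∑ x ∈ S, g x ^ 2 := sq_sum_le_card_mul_sum_sq
  have h3 : ∑ x ∈ S, g x ^ 2 ≤ (16 : ℝ) ^ N * ((L : ℝ) ^ d *
      ∑ i : Fin d, ∑ k, ‖((fwdDiff (blockStep L A • (Pi.single i (1 : ZMod L) : TorusSite d L)))^[N] h) k‖ ^ 2) :=
    sum_cubeShell_norm_sq_le h hA N
  have hcard : (Fintype.card (TorusSite d L) : ℝ) = (L : ℝ) ^ d := by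
    rw [Fintype.card_pi, prod_const, ZMod.card, card_univ, Fintype.card_fin]; push_cast; rfl
  have h4 : ∑ i : Fin d, ∑ k, ‖((fwdDiff (blockStep L A • (Pi.single i (1 : ZMod L) : TorusSite d L)))^[N] h) k‖ ^ 2 ≤
      (d : ℝ) * ((L : ℝ) ^ d * D ^ 2) := by
    have hin : ∀ i : Fin d,
        ∑ k, ‖((fwdDiff (blockStep L A • (Pi.single i (1 : ZMod L) : TorusSite d L)))^[N] h) k‖ ^ 2 ≤ (L : ℝ) ^ d * D ^ 2 := by
      intro i
      calc ∑ k, ‖((fwdDiff (blockStep L A • (Pi.single i (1 : ZMod L) : TorusSite d L)))^[N] h) k‖ ^ 2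
          ≤ ∑ _k : TorusSite d L, D ^ 2 :=
            sum_le_sum fun k _ => pow_le_pow_left₀ (norm_nonneg _) (hD i k) 2
        _ = (L : ℝ) ^ d * D ^ 2 := by rw [sum_const, card_univ, nsmul_eq_mul, hcard]
    calc ∑ i : Fin d, ∑ k, ‖((fwdDiff (blockStep L A • (Pi.single i (1 : ZMod L) : TorusSite d L)))^[N] h) k‖ ^ 2
        ≤ ∑ _i : Fin d, (L : ℝ) ^ d * D ^ 2 := sum_le_sum fun i _ => hin i
      _ = (d : ℝ) * ((L : ℝ) ^ d * D ^ 2) := by rw [sum_const, card_univ, Fintype.card_fin, nsmul_eq_mul]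
  have h5 : (#S : ℝ) ≤ (4 * A : ℝ) ^ d := by exact_mod_cast card_cubeShell_le (d := d) (L := L) A
  set B : ℝ := Real.sqrt ((4 * A : ℝ) ^ d) * (4 : ℝ) ^ N * Real.sqrt d * (L : ℝ) ^ d * D with hB
  have hB0 : 0 ≤ B := by positivity
  have hsq : (∑ x ∈ S, g x) ^ 2 ≤ B ^ 2 := by
    have hS0 : 0 ≤ ∑ x ∈ S, g x ^ 2 := sum_nonneg fun x _ => sq_nonneg _
    calc (∑ x ∈ S, g x) ^ 2 ≤ #S * ∑ x ∈ S, g x ^ 2 := h2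
      _ ≤ (4 * A : ℝ) ^ d * ((16 : ℝ) ^ N * ((L : ℝ) ^ d * ((d : ℝ) * ((L : ℝ) ^ d * D ^ 2)))) := by
          refine mul_le_mul h5 (h3.trans ?_) hS0 (by positivity)
          exact mul_le_mul_of_nonneg_left (mul_le_mul_of_nonneg_left h4 hL) (by positivity)
      _ = B ^ 2 := by
          rw [hB]
          have hs1 : Real.sqrt ((4 * A : ℝ) ^ d) ^ 2 = (4 * A : ℝ) ^ d := Real.sq_sqrt (by positivity)
          have hs2 : Real.sqrt (d : ℝ) ^ 2 = d := Real.sq_sqrt (Nat.cast_nonneg d)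
          have h16 : ((4 : ℝ) ^ N) ^ 2 = (16 : ℝ) ^ N := by rw [← pow_mul, mul_comm, pow_mul]; norm_num
          calc (4 * A : ℝ) ^ d * ((16 : ℝ) ^ N * ((L : ℝ) ^ d * ((d : ℝ) * ((L : ℝ) ^ d * D ^ 2))))
              = Real.sqrt ((4 * A : ℝ) ^ d) ^ 2 * (((4 : ℝ) ^ N) ^ 2 * ((L : ℝ) ^ d * (Real.sqrt (d : ℝ) ^ 2 * ((L : ℝ) ^ d * D ^ 2)))) := by
                rw [hs1, hs2, h16]
            _ = _ := by ring
  have h6 : ∑ x ∈ S, g x ≤ B := by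
    have := Real.sqrt_le_sqrt hsq
    rwa [Real.sqrt_sq (sum_nonneg fun x _ => hg0 x), Real.sqrt_sq hB0] at this
  exact h1.trans (mul_le_mul_of_nonneg_left h6 hW)

/-- The same bound in the KERNEL normalisation `L^{-d}·Σ_k χ_k(x) h(k)` (the lattice position kernel of the symbol `h`):
`Σ_{x ∈ S_A} w(x) ‖L^{-d} Σ_k χ_k(x) h(k)‖ ≤ W · √((4A)^d) · 4^N · √d · D` — uniformly in `L`.
[cite: Zygmund2002, Ch. VI §3 Thm 3.1] -/
theorem sum_cubeShell_weight_mul_norm_kernel_le (h : TorusSite d L → ℂ) {A : ℕ} (hA : 0 < A) (N : ℕ)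
    (w : TorusSite d L → ℝ) {W D : ℝ} (hW : 0 ≤ W) (hD0 : 0 ≤ D) (hwW : ∀ x ∈ cubeShell d L A, w x ≤ W)
    (hD : ∀ (i : Fin d) (k : TorusSite d L),
      ‖((fwdDiff (blockStep L A • (Pi.single i (1 : ZMod L) : TorusSite d L)))^[N] h) k‖ ≤ D) :
    ∑ x ∈ cubeShell d L A, w x * ‖((L : ℂ) ^ d)⁻¹ * ∑ k, torusChar k x * h k‖ ≤
      W * (Real.sqrt ((4 * A : ℝ) ^ d) * (4 : ℝ) ^ N * Real.sqrt d * D) := by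
  have hL0 : (0 : ℝ) < (L : ℝ) ^ d := by
    have : (0 : ℝ) < L := by exact_mod_cast Nat.pos_of_ne_zero (NeZero.ne L)
    positivity
  have hnorm : ∀ x : TorusSite d L, ‖((L : ℂ) ^ d)⁻¹ * ∑ k, torusChar k x * h k‖ = ((L : ℝ) ^ d)⁻¹ * ‖∑ k, torusChar k x * h k‖ := by
    intro x
    rw [norm_mul, norm_inv, norm_pow, Complex.norm_natCast]
  have hrw : ∑ x ∈ cubeShell d L A, w x * ‖((L : ℂ) ^ d)⁻¹ * ∑ k, torusChar k x * h k‖ =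
      ((L : ℝ) ^ d)⁻¹ * ∑ x ∈ cubeShell d L A, w x * ‖∑ k, torusChar k x * h k‖ := by
    rw [mul_sum]
    exact sum_congr rfl fun x _ => by rw [hnorm]; ring
  rw [hrw, inv_mul_le_iff₀ hL0]
  calc ∑ x ∈ cubeShell d L A, w x * ‖∑ k, torusChar k x * h k‖
      ≤ W * (Real.sqrt ((4 * A : ℝ) ^ d) * (4 : ℝ) ^ N * Real.sqrt d * (L : ℝ) ^ d * D) :=
        sum_cubeShell_weight_mul_norm_le h hA N w hW hD0 hwW hD
    _ = (L : ℝ) ^ d * (W * (Real.sqrt ((4 * A : ℝ) ^ d) * (4 : ℝ) ^ N * Real.sqrt d * D)) := by ring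

/-! ### §5 The dyadic cover and the two-law summation -/

/-- **Dyadic cover**: a nonnegative function on the torus is summed by its value at `0` plus its sums over the cube shells of
scales `2^j`, `j ≤ log₂ L` (every `x ≠ 0` has `1 ≤ |x̃|_∞ ≤ L/2` and lies in the shell of scale `2^{⌊log₂ |x̃|_∞⌋}`).
[cite: Zygmund2002, Ch. VI §3 Thm 3.1] -/
theorem sum_le_apply_zero_add_sum_cubeShell (F : TorusSite d L → ℝ) (hF : ∀ x, 0 ≤ F x) :
    ∑ x, F x ≤ F 0 + ∑ j ∈ range (Nat.log 2 L + 1), ∑ x ∈ cubeShell d L (2 ^ j), F x := by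
  -- pointwise cover with multiplicity
  have hcover : ∀ x : TorusSite d L,
      F x ≤ (if x = 0 then F x else 0) + ∑ j ∈ range (Nat.log 2 L + 1), if x ∈ cubeShell d L (2 ^ j) then F x else 0 := by
    intro x
    have hnn : ∀ j ∈ range (Nat.log 2 L + 1), 0 ≤ (if x ∈ cubeShell d L (2 ^ j) then F x else 0) := by
      intro j _
      split_ifs
      · exact hF x
      · exact le_rfl
    by_cases hx : x = 0
    · rw [if_pos hx]
      exact le_add_of_nonneg_right (sum_nonneg hnn)
    · rw [if_neg hx, zero_add]
      set n := torusSupNorm x with hn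
      have hn0 : n ≠ 0 := fun h0 => hx ((torusSupNorm_eq_zero_iff x).1 h0)
      set j := Nat.log 2 n with hj
      have hjmem : j ∈ range (Nat.log 2 L + 1) := by
        rw [mem_range, Nat.lt_succ_iff]
        exact Nat.log_mono_right ((torusSupNorm_le_half x).trans (Nat.div_le_self L 2))
      have hxmem : x ∈ cubeShell d L (2 ^ j) := by
        rw [mem_cubeShell]
        refine ⟨Nat.pow_log_le_self 2 hn0, ?_⟩
        rw [← pow_succ']
        exact Nat.lt_pow_succ_log_self one_lt_two n
      calc F x = if x ∈ cubeShell d L (2 ^ j) then F x else 0 := by rw [if_pos hxmem]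
        _ ≤ ∑ j' ∈ range (Nat.log 2 L + 1), if x ∈ cubeShell d L (2 ^ j') then F x else 0 :=
            Finset.single_le_sum (f := fun j' => if x ∈ cubeShell d L (2 ^ j') then F x else 0) hnn hjmem
  calc ∑ x, F x
      ≤ ∑ x, ((if x = 0 then F x else 0) + ∑ j ∈ range (Nat.log 2 L + 1), if x ∈ cubeShell d L (2 ^ j) then F x else 0) :=
        sum_le_sum fun x _ => hcover x
    _ = F 0 + ∑ j ∈ range (Nat.log 2 L + 1), ∑ x ∈ cubeShell d L (2 ^ j), F x := by
        rw [sum_add_distrib, Finset.sum_ite_eq' univ (0 : TorusSite d L) F, if_pos (mem_univ _), sum_comm]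
        congr 1
        refine sum_congr rfl fun j _ => ?_
        rw [Finset.sum_ite_mem, univ_inter]

/-- **The two-law summation**: for `a, b ≥ 0` and every integer crossover `t`,
`Σ_{j < J} min(a·2^j, b/2^j) ≤ a·2^t + 2b/2^t` (the growing law below `t`, the decaying law from `t` on; with `2^t ≍ √(b/a)` this
is `≲ √(ab)`, independently of `J`). [cite: Zygmund2002, Ch. VI §3 Thm 3.1] -/
theorem sum_min_geom_le {a b : ℝ} (ha : 0 ≤ a) (hb : 0 ≤ b) (J t : ℕ) :
    ∑ j ∈ range J, min (a * 2 ^ j) (b / 2 ^ j) ≤ a * 2 ^ t + 2 * b / 2 ^ t := by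
  have hsplit : ∑ j ∈ range J, min (a * 2 ^ j) (b / 2 ^ j) ≤
      ∑ j ∈ range J, (if j < t then a * 2 ^ j else b / 2 ^ j) := by
    refine sum_le_sum fun j _ => ?_
    split_ifs
    · exact min_le_left _ _
    · exact min_le_right _ _
  rw [Finset.sum_ite] at hsplit
  refine hsplit.trans (add_le_add ?_ ?_)
  · -- the growing law: `Σ_{j < t} a 2^j = a (2^t - 1) ≤ a 2^t`
    calc ∑ j ∈ (range J).filter (fun j => j < t), a * 2 ^ j
        ≤ ∑ j ∈ range t, a * 2 ^ j := by
          refine sum_le_sum_of_subset_of_nonneg (fun j hj => ?_) fun j _ _ => by positivity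
          rw [mem_filter] at hj
          exact mem_range.2 hj.2
      _ = a * (2 ^ t - 1) := by
          rw [← mul_sum, geom_sum_eq (by norm_num : (2 : ℝ) ≠ 1)]
          norm_num
      _ ≤ a * 2 ^ t := by nlinarith
  · -- the decaying law: `Σ_{t ≤ j < J} b/2^j ≤ 2b/2^t`
    have hset : (range J).filter (fun j => ¬ j < t) = Ico t J := by
      ext j
      simp only [mem_filter, mem_range, mem_Ico, not_lt]
      tauto
    rw [hset]
    have hgeo := geom_sum_Ico_le_of_lt_one (by norm_num : (0 : ℝ) ≤ 1 / 2) (by norm_num : (1 / 2 : ℝ) < 1) (m := t) (n := J)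
    calc ∑ j ∈ Ico t J, b / 2 ^ j = b * ∑ j ∈ Ico t J, (1 / 2 : ℝ) ^ j := by
          rw [mul_sum]
          refine sum_congr rfl fun j _ => ?_
          rw [one_div_pow, div_eq_mul_one_div]
      _ ≤ b * ((1 / 2 : ℝ) ^ t / (1 - 1 / 2)) := mul_le_mul_of_nonneg_left hgeo hb
      _ = 2 * b / 2 ^ t := by rw [one_div_pow]; ring

/-- **The dyadic bound for a weighted `ℓ¹` norm of a lattice position kernel from TWO difference laws**: if on the shell of scale
`2^j` the weight is at most `W j` and the `N₁`-th (resp. `N₂`-th) coarse axis differences of the symbol are at most `D₁ j` (resp.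
`D₂ j`; only the nonempty shells `2·2^j ≤ L` need the difference bounds), then
`Σ_x w(x)‖L^{-d}Σ_k χ_k(x)h(k)‖ ≤ w(0)‖L^{-d}Σ_k h(k)‖ + Σ_{j ≤ log₂ L} W j · √((4·2^j)^d) · √d · min(4^{N₁}D₁ j, 4^{N₂}D₂ j)` —
each shell paid by the better of the two laws (then `sum_min_geom_le`). [cite: Zygmund2002, Ch. VI §3 Thm 3.1] -/
theorem sum_weight_mul_norm_kernel_le_dyadic (h : TorusSite d L → ℂ) (w : TorusSite d L → ℝ) (hw0 : ∀ x, 0 ≤ w x)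
    (N₁ N₂ : ℕ) (W D₁ D₂ : ℕ → ℝ) (hW : ∀ j, 0 ≤ W j) (hD₁0 : ∀ j, 0 ≤ D₁ j) (hD₂0 : ∀ j, 0 ≤ D₂ j)
    (hwW : ∀ j, ∀ x ∈ cubeShell d L (2 ^ j), w x ≤ W j)
    (hD₁ : ∀ (j : ℕ), 2 * 2 ^ j ≤ L → ∀ (i : Fin d) (k : TorusSite d L),
      ‖((fwdDiff (blockStep L (2 ^ j) • (Pi.single i (1 : ZMod L) : TorusSite d L)))^[N₁] h) k‖ ≤ D₁ j)
    (hD₂ : ∀ (j : ℕ), 2 * 2 ^ j ≤ L → ∀ (i : Fin d) (k : TorusSite d L),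
      ‖((fwdDiff (blockStep L (2 ^ j) • (Pi.single i (1 : ZMod L) : TorusSite d L)))^[N₂] h) k‖ ≤ D₂ j) :
    ∑ x, w x * ‖((L : ℂ) ^ d)⁻¹ * ∑ k, torusChar k x * h k‖ ≤
      w 0 * ‖((L : ℂ) ^ d)⁻¹ * ∑ k, h k‖ +
        ∑ j ∈ range (Nat.log 2 L + 1),
          W j * (Real.sqrt ((4 * (2 : ℝ) ^ j) ^ d) * Real.sqrt d * min ((4 : ℝ) ^ N₁ * D₁ j) ((4 : ℝ) ^ N₂ * D₂ j)) := by
  have hpos : ∀ j : ℕ, 0 < 2 ^ j := fun j => Nat.two_pow_pos j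
  have h0 := sum_le_apply_zero_add_sum_cubeShell (d := d) (L := L)
    (fun x => w x * ‖((L : ℂ) ^ d)⁻¹ * ∑ k, torusChar k x * h k‖) fun x => mul_nonneg (hw0 x) (norm_nonneg _)
  simp only [torusChar_zero_right, one_mul] at h0
  refine h0.trans (add_le_add le_rfl (sum_le_sum fun j _ => ?_))
  have hA : ((2 ^ j : ℕ) : ℝ) = (2 : ℝ) ^ j := by push_cast; rfl
  by_cases hjL : 2 * 2 ^ j ≤ L
  · rcases le_total ((4 : ℝ) ^ N₁ * D₁ j) ((4 : ℝ) ^ N₂ * D₂ j) with hle | hle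
    · rw [min_eq_left hle]
      have := sum_cubeShell_weight_mul_norm_kernel_le h (hpos j) N₁ w (hW j) (hD₁0 j) (hwW j) (hD₁ j hjL)
      rw [hA] at this
      refine this.trans (le_of_eq ?_)
      ring
    · rw [min_eq_right hle]
      have := sum_cubeShell_weight_mul_norm_kernel_le h (hpos j) N₂ w (hW j) (hD₂0 j) (hwW j) (hD₂ j hjL)
      rw [hA] at this
      refine this.trans (le_of_eq ?_)
      ring
  · -- empty shell
    rw [cubeShell_eq_empty_of_lt (not_le.1 hjL), sum_empty]
    have : 0 ≤ min ((4 : ℝ) ^ N₁ * D₁ j) ((4 : ℝ) ^ N₂ * D₂ j) :=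
      le_min (mul_nonneg (by positivity) (hD₁0 j)) (mul_nonneg (by positivity) (hD₂0 j))
    exact mul_nonneg (hW j) (by positivity)

end Literature.Probability.LatticeModels

end
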